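import Mathlib.Analysis.SpecialFunctions.Pow.Asymptotics
import Literature.Barriers.ABC.NoArithmeticDerivativeAbcEstimateProofs
import Literature.Barriers.ABC.NoArithmeticDerivativeProofs
import Literature.NumberTheory.DiophantineGeometry.AbcWave0QualityFormProofs
import HarnessLib

/-!
# Small Derivatives ⟹ Oesterlé's abc (Pasten, Lemma 4.1 / Cor. 4.6) and the `η > 1` version of
# the Small Derivatives Conjecture (Pasten, §3.3 via Lemma 3.5) — proved; the conjecture itself
# (`η < 1`) is open

Sibling proof file of `NoArithmeticDerivative.lean` for its sub-namespace `Pasten` (the evasion on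
record of the barrier `IntegersHaveNoDerivation`, audit 2026-08-15; D-0014): theorems only, no new
definitions, no named facts. Source: H. Pasten, *Arithmetic derivatives through geometry of
numbers*, Canad. Math. Bull. (2022), arXiv:2106.16165 [cite: Pasten2021].

## Results

`exists_exponent_of_smallDerivatives_holds : exists_exponent_of_smallDerivatives` DISCHARGES the
named fact recording Lemma 4.1 / Corollary 4.6 (second half): the Small Derivatives Conjecture
(Conjecture 3.9) implies Oesterlé's abc conjecture (Conjecture 3.2: `∃ M, c < rad(abc)^M` for
every abc triple). Proof as printed (p. 9 of the arXiv version), made fully explicit: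

* the excluded triples — `(1, N, q)` with `q` prime, up to order — satisfy
  `rad(abc) ≥ 2q > q + 1 ≥ c` ("hence, the abc Conjecture holds in such cases"):
  `lt_rad_of_isExcludedTriple`, the triple `(1, 1, 2)` (where `c = rad(abc) = 2`) set apart;
* outside the finite exceptional set of Conjecture 3.9, Theorem 3.3 — the tree's
  `abc_estimate_holds` (`NoArithmeticDerivativeAbcEstimateProofs`) — applied with `‖ψ‖ < c^η`
  gives `c / log c ≤ rad(abc) · c^η / log 2`; with `log c ≤ c^δ/δ`, `δ = (1 − η)/2`, and
  `rad(abc) ≥ 2` this becomes `c < rad(abc)^M` for the explicit exponent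
  `M = (1 + log₂ K)/δ + 1`, `K = 1/(δ log 2)` (Pasten: "every `M > 1/(1 − η)`" for all but
  finitely many triples; the weaker explicit `M` suffices for Conjecture 3.2 as recorded);
* the finitely many exceptional triples have `c ≤ C₀ < 2^{C₀+1} ≤ rad(abc)^{C₀+1}`;
the final exponent is the maximum of the three.

`smallDerivativesConjectureWith_of_one_lt : 1 < η → SmallDerivativesConjectureWith η` is the
unconditional evidence the source prints right after Conjecture 3.9: "Lemma 3.5 shows that if we
keep the `ψ`-independence condition, then a version of the Small Derivatives Conjecture holds with
exponent `η = 1 + ε` rather than the sought `η < 1`" [cite: Pasten2021, §3.3 (remark after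
Conj. 3.9) with Lemma 3.5]. Proof: Lemma 3.5 — the tree's `exists_adapted_independent_holds`
(`NoArithmeticDerivativeProofs`) — gives, for `(a, b) ≠ (1, 1)`, a `ψ`-independent `ψ ∈ 𝒯(a,b)`
with `‖ψ‖ ≤ ω(abc)/(2 log 2) · c log c`; since `2^{ω(abc)} ≤ abc ≤ c³` this is
`≤ 3 c (log c)²/(2 (log 2)²) < c · c^{η−1} = c^η` as soon as `c ≥ N(η)`
(`(log x)² = o(x^{η−1})`, Mathlib's `isLittleO_log_rpow_rpow_atTop`), so every exceptional
triple has `a, b ≤ c < max N 3` and the exceptional set is finite (no excluded triples need to be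
removed). Together with `exists_exponent_of_smallDerivatives_holds` this pins the open content of
Conjecture 3.9 to the range `η < 1` ("the crucial aspects ... are that the exponent `η` is strictly
less than `1` and that `a, b` must be `ψ`-independent").

## What is deliberately NOT here: `SmallDerivativesConjecture_holds`

`Pasten.SmallDerivativesConjecture` (Conjecture 3.9 = Conjecture 1.2 of the source) is an OPEN
conjecture, not a theorem: by Corollary 4.6 it is implied by the Masser–Oesterlé abc conjecture
(Conjecture 3.1) and implies Oesterlé's abc conjecture (Conjecture 3.2), and of both the source
says "To the best of the author's knowledge, they remain open" (§3.1)
[cite: Pasten2021, §3.1 and Cor. 4.6]. With the theorem below, a Lean proof of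
`SmallDerivativesConjecture` would be, verbatim, a Lean proof of
`∃ M, ∀ a b c, IsABCTriple a b c → c < rad(abc)^M` — cf. the identical verdict recorded on
`Literature.NumberTheory.DiophantineGeometry.ABCQualityForm` in `AbcWave0` ("no proof is in print,
so there is no `ABCQualityForm_holds`"). The Lean statement was audited against Conjecture 3.9 as
printed — `ψ ∈ 𝒯(a,b)` as support on the primes of `ab(a+b)` plus (EqnAdd), `ψ`-independence as
`W^ψ(a,b) ≠ 0`, `‖ψ‖ < c^η` as `∀ p, |ψ(ξ_p)| < c^η` (a `sup` over a finite support), the excluded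
triples `(1, N, q)` up to order as `IsExcludedTriple`, "all but finitely many" as finiteness of the
set of ordered exceptions, `∃` an absolute `0 < η < 1` — and found faithful; it therefore stays a
`def … : Prop`, to be used only as a hypothesis `(h : SmallDerivativesConjecture)`.
Also not here: `smallDerivatives_of_abcQualityForm` (abc ⟹ Small Derivatives, Theorem 4.5),
whose printed proof needs the Bombieri–Vaaler form of Siegel's lemma (Theorems 2.5–2.6); its
discharge by an elementary cube pigeonhole is the business of the companion files
`NoArithmeticDerivativeSmallDerivCore` / `NoArithmeticDerivativeSmallDerivCube`.
-/

noncomputable section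

open Literature.NumberTheory.DiophantineGeometry UniqueFactorizationMonoid Finset

namespace Literature.Barriers.ABC

namespace Pasten

/-! ### Lemma 4.1: Small Derivatives ⟹ Oesterlé's abc -/

/-- The excluded triples other than `(1, 1, 2)` satisfy `c < rad(abc)`: up to order they are
`(1, N, q)` with `q` prime and `N ≥ 2`, and `rad(abc) ≥ 2q > q + 1 ≥ c` (Pasten, proof of
Lemma 4.1). [cite: Pasten2021, Lemma 4.1] -/
theorem lt_rad_of_isExcludedTriple {a b c : ℕ} (habc : IsABCTriple a b c)
    (hex : IsExcludedTriple a b c) (h11 : (a, b) ≠ (1, 1)) : c < rad a b c := by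
  -- `q` prime, coprime to `m ≥ 2` ⟹ `2q ≤ rad(qm)`
  have key : ∀ q m : ℕ, q.Prime → Nat.Coprime q m → 2 ≤ m → 2 * q ≤ radical (q * m) := by
    intro q m hq hqm hm
    have hrel : IsRelPrime q m := Nat.coprime_iff_isRelPrime.mp hqm
    rw [radical_mul hrel, radical_of_prime hq.prime, normalize_eq, mul_comm 2 q]
    exact Nat.mul_le_mul_left q (Nat.two_le_radical_iff.mpr hm)
  obtain ⟨ha, hb, hsum, -⟩ := habc
  rw [rad_def]
  subst hsum
  rcases hex with ⟨rfl, hbq | hcq⟩ | ⟨rfl, haq | hcq⟩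
  · -- `a = 1`, `b` prime
    have h := key b (1 + b) hbq (by simp) (by omega)
    have hb2 := hbq.two_le
    rw [show 1 * b * (1 + b) = b * (1 + b) by ring]
    omega
  · -- `a = 1`, `c = 1 + b` prime, `b ≥ 2`
    have hb2 : 2 ≤ b := by
      rcases Nat.lt_or_ge b 2 with h | h
      · interval_cases b; simp_all
      · exact h
    have h := key (1 + b) b hcq (by simp) hb2
    rw [show 1 * b * (1 + b) = (1 + b) * b by ring]
    omega
  · -- `b = 1`, `a` prime
    have h := key a (a + 1) haq (by simp) (by omega)
    have ha2 := haq.two_le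
    rw [show a * 1 * (a + 1) = a * (a + 1) by ring]
    omega
  · -- `b = 1`, `c = a + 1` prime, `a ≥ 2`
    have ha2 : 2 ≤ a := by
      rcases Nat.lt_or_ge a 2 with h | h
      · interval_cases a; simp_all
      · exact h
    have h := key (a + 1) a hcq (by simp) ha2
    rw [show a * 1 * (a + 1) = (a + 1) * a by ring]
    omega

/-- **Small Derivatives ⟹ Oesterlé's abc (Pasten, Lemma 4.1 / Corollary 4.6, second half),
discharged**: the named fact `exists_exponent_of_smallDerivatives` holds. As printed: outside the
finite exceptional set, Theorem 3.3 with `‖ψ‖ < c^η` gives `c / log c < rad(abc) c^η / log 2`,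
whence (using `log c ≤ c^δ/δ`, `δ = (1 − η)/2`, and `rad(abc) ≥ 2`) `c < rad(abc)^M` for an
explicit `M = M(η)`; the excluded triples have `c < rad(abc)` (`lt_rad_of_isExcludedTriple`) or are
`(1, 1, 2)`; the finitely many exceptional triples have `c ≤ C₀ < 2^{C₀+1} ≤ rad(abc)^{C₀+1}`.
Consequently a proof of `SmallDerivativesConjecture` would be a proof of Oesterlé's abc conjecture
(Pasten's Conjecture 3.2), which is open [cite: Pasten2021, Lemma 4.1, Cor. 4.6 and §3.1]. -/
theorem exists_exponent_of_smallDerivatives_holds : exists_exponent_of_smallDerivatives := by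
  rintro ⟨η, hη0, hη1, hfin⟩
  set S : Set (ℕ × ℕ × ℕ) := {t : ℕ × ℕ × ℕ | IsABCTriple t.1 t.2.1 t.2.2 ∧
      ¬ IsExcludedTriple t.1 t.2.1 t.2.2 ∧
      ¬ ∃ ψ : ℕ → ℤ, IsAdapted ψ t.1 t.2.1 ∧ wronskian ψ t.1 t.2.1 ≠ 0 ∧
          ∀ p : ℕ, (|ψ p| : ℝ) < (t.2.2 : ℝ) ^ η} with hS
  -- a bound for `c` on the finite exceptional set
  obtain ⟨C₀, hC₀⟩ : ∃ C₀ : ℕ, ∀ t ∈ S, t.2.2 ≤ C₀ :=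
    ⟨hfin.toFinset.sup fun t => t.2.2, fun t ht =>
      Finset.le_sup (f := fun t : ℕ × ℕ × ℕ => t.2.2) (hfin.mem_toFinset.mpr ht)⟩
  -- constants for the generic case
  have hlog2 : 0 < Real.log 2 := Real.log_pos one_lt_two
  obtain ⟨δ, hδ⟩ : ∃ δ : ℝ, δ = (1 - η) / 2 := ⟨_, rfl⟩
  have hδ0 : 0 < δ := by rw [hδ]; linarith
  have hδhalf : δ < 1 / 2 := by rw [hδ]; linarith
  obtain ⟨K, hK⟩ : ∃ K : ℝ, K = 1 / (δ * Real.log 2) := ⟨_, rfl⟩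
  have hK1 : 1 ≤ K := by
    rw [hK, le_div_iff₀ (by positivity), one_mul]
    have h2 : Real.log 2 < 1 := by
      have := Real.log_two_lt_d9
      linarith
    nlinarith [mul_pos (sub_pos.mpr hδhalf) hlog2]
  have hK0 : 0 < K := by linarith
  have hlogbK : 0 ≤ Real.logb 2 K := Real.logb_nonneg one_lt_two hK1
  obtain ⟨M₃, hM₃⟩ : ∃ M : ℝ, M = (1 + Real.logb 2 K) / δ + 1 := ⟨_, rfl⟩
  refine ⟨max (max ((C₀ : ℝ) + 1) 2) M₃, ?_⟩
  intro a b c habc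
  have hR2 : (2 : ℝ) ≤ (rad a b c : ℝ) := by exact_mod_cast habc.two_le_rad
  have hR1 : (1 : ℝ) ≤ (rad a b c : ℝ) := by linarith
  have hc2 : 2 ≤ c := habc.two_le
  by_cases hmem : (a, b, c) ∈ S
  · -- exceptional triple: `c ≤ C₀ < 2 ^ (C₀ + 1) ≤ rad(abc) ^ (C₀ + 1) ≤ rad(abc) ^ M`
    have h1 : c ≤ C₀ := hC₀ _ hmem
    have hlt : c < 2 ^ (C₀ + 1) :=
      lt_of_le_of_lt h1 (Nat.lt_two_pow_self.trans_le (Nat.pow_le_pow_right two_pos (by omega)))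
    calc (c : ℝ) < (2 : ℝ) ^ ((C₀ : ℝ) + 1) := by
          rw [show ((C₀ : ℝ) + 1) = ((C₀ + 1 : ℕ) : ℝ) by push_cast; ring, Real.rpow_natCast]
          exact_mod_cast hlt
      _ ≤ (rad a b c : ℝ) ^ ((C₀ : ℝ) + 1) := Real.rpow_le_rpow (by norm_num) hR2 (by positivity)
      _ ≤ (rad a b c : ℝ) ^ max (max ((C₀ : ℝ) + 1) 2) M₃ :=
          Real.rpow_le_rpow_of_exponent_le hR1 (le_max_of_le_left (le_max_left _ _))
  by_cases hex : IsExcludedTriple a b c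
  · by_cases h11 : (a, b) = (1, 1)
    · -- `(1, 1, 2)`: `rad = 2`, `2 < 2 ^ 2 ≤ rad ^ M`
      obtain ⟨rfl, rfl⟩ := Prod.mk.inj h11
      have hc : c = 2 := by obtain ⟨-, -, hs, -⟩ := habc; omega
      subst hc
      calc ((2 : ℕ) : ℝ) < (2 : ℝ) ^ (2 : ℝ) := by norm_num
        _ ≤ (rad 1 1 2 : ℝ) ^ (2 : ℝ) := Real.rpow_le_rpow (by norm_num) hR2 (by norm_num)
        _ ≤ (rad 1 1 2 : ℝ) ^ max (max ((C₀ : ℝ) + 1) 2) M₃ :=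
          Real.rpow_le_rpow_of_exponent_le hR1 (le_max_of_le_left (le_max_right _ _))
    · have hlt := lt_rad_of_isExcludedTriple habc hex h11
      calc (c : ℝ) < (rad a b c : ℝ) := by exact_mod_cast hlt
        _ = (rad a b c : ℝ) ^ (1 : ℝ) := (Real.rpow_one _).symm
        _ ≤ (rad a b c : ℝ) ^ max (max ((C₀ : ℝ) + 1) 2) M₃ :=
          Real.rpow_le_rpow_of_exponent_le hR1
            (le_max_of_le_left (le_max_of_le_right one_le_two))
  -- generic triple: a small `ψ`-independent `ψ ∈ 𝒯(a,b)` exists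
  have hψ : ∃ ψ : ℕ → ℤ, IsAdapted ψ a b ∧ wronskian ψ a b ≠ 0 ∧
      ∀ p : ℕ, (|ψ p| : ℝ) < (c : ℝ) ^ η := by
    by_contra hno
    exact hmem ⟨habc, hex, hno⟩
  obtain ⟨ψ, had, hW, hsmall⟩ := hψ
  have h11 : (a, b) ≠ (1, 1) := by
    intro h
    obtain ⟨rfl, rfl⟩ := Prod.mk.inj h
    have hc : c = 2 := by obtain ⟨-, -, hs, -⟩ := habc; omega
    exact hex (Or.inl ⟨rfl, Or.inr (hc ▸ Nat.prime_two)⟩)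
  have hsum : a + b = c := habc.2.2.1
  have hest : (c : ℝ) / Real.log c ≤ (rad a b c : ℝ) * (c : ℝ) ^ η / Real.log 2 := by
    have h := abc_estimate_holds a b ψ ((c : ℝ) ^ η) (by rw [hsum]; exact habc) h11 had hW
      fun p => (hsmall p).le
    simpa only [hsum] using h
  have hx0 : (0 : ℝ) < c := by positivity
  have hx1 : (1 : ℝ) < c := by exact_mod_cast hc2
  have hlogc : 0 < Real.log c := Real.log_pos hx1
  obtain ⟨R, hR⟩ : ∃ R : ℝ, R = (rad a b c : ℝ) := ⟨_, rfl⟩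
  rw [← hR] at hR2 hR1 hest ⊢
  have hR0 : 0 < R := by linarith
  -- `c ≤ R c^η log c / log 2 ≤ R K c^(η+δ)`
  have h1 : (c : ℝ) ≤ R * (c : ℝ) ^ η * Real.log c / Real.log 2 := by
    have h := (div_le_iff₀ hlogc).mp hest
    calc (c : ℝ) ≤ R * (c : ℝ) ^ η / Real.log 2 * Real.log c := h
      _ = _ := by ring
  have h2 : Real.log c ≤ (c : ℝ) ^ δ / δ := Real.log_le_rpow_div hx0.le hδ0
  have h3 : (c : ℝ) ≤ R * K * (c : ℝ) ^ (η + δ) := by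
    calc (c : ℝ) ≤ R * (c : ℝ) ^ η * Real.log c / Real.log 2 := h1
      _ ≤ R * (c : ℝ) ^ η * ((c : ℝ) ^ δ / δ) / Real.log 2 :=
          div_le_div_of_nonneg_right (mul_le_mul_of_nonneg_left h2 (by positivity)) hlog2.le
      _ = R * K * ((c : ℝ) ^ η * (c : ℝ) ^ δ) := by
          rw [hK]
          field_simp
      _ = R * K * (c : ℝ) ^ (η + δ) := by rw [← Real.rpow_add hx0]
  -- divide by `c^(η+δ)`: `c^δ ≤ R K` since `δ + (η + δ) = 1`
  have h4 : (c : ℝ) ^ δ ≤ R * K := by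
    have h3' : (c : ℝ) ^ δ * (c : ℝ) ^ (η + δ) ≤ R * K * (c : ℝ) ^ (η + δ) :=
      calc (c : ℝ) ^ δ * (c : ℝ) ^ (η + δ) = (c : ℝ) := by
            rw [← Real.rpow_add hx0, show δ + (η + δ) = 1 by rw [hδ]; ring, Real.rpow_one]
        _ ≤ R * K * (c : ℝ) ^ (η + δ) := h3
    exact le_of_mul_le_mul_right h3' (Real.rpow_pos_of_pos hx0 _)
  -- `R K ≤ R ^ (1 + log₂ K)` since `R ≥ 2`
  have h5 : R * K ≤ R ^ (1 + Real.logb 2 K) := by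
    rw [Real.rpow_add hR0, Real.rpow_one]
    apply mul_le_mul_of_nonneg_left _ hR0.le
    calc K = (2 : ℝ) ^ Real.logb 2 K := (Real.rpow_logb two_pos (by norm_num) hK0).symm
      _ ≤ R ^ Real.logb 2 K := Real.rpow_le_rpow (by norm_num) hR2 hlogbK
  -- `c = (c^δ)^(1/δ) ≤ R ^ ((1 + log₂ K)/δ)`
  have h6 : (c : ℝ) ≤ R ^ ((1 + Real.logb 2 K) / δ) := by
    have hcδ : (c : ℝ) = ((c : ℝ) ^ δ) ^ (1 / δ) := by
      rw [← Real.rpow_mul hx0.le, mul_one_div_cancel hδ0.ne', Real.rpow_one]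
    rw [hcδ, div_eq_mul_one_div (1 + Real.logb 2 K) δ, Real.rpow_mul hR0.le]
    exact Real.rpow_le_rpow (by positivity) (h4.trans h5) (by positivity)
  calc (c : ℝ) < (c : ℝ) * 2 := by linarith
    _ ≤ R ^ ((1 + Real.logb 2 K) / δ) * R := mul_le_mul h6 hR2 zero_le_two (by positivity)
    _ = R ^ M₃ := by rw [hM₃, Real.rpow_add hR0, Real.rpow_one]
    _ ≤ R ^ max (max ((C₀ : ℝ) + 1) 2) M₃ := Real.rpow_le_rpow_of_exponent_le hR1 (le_max_right _ _)

/-! ### The `η > 1` version of the Small Derivatives Conjecture (Pasten §3.3, via Lemma 3.5) -/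

/-- `2 ^ ω(n) ≤ n` for `n ≠ 0` (so `ω(n) ≤ log₂ n`): the distinct prime factors are `≥ 2` and their
product divides `n`. [folklore] -/
private theorem two_pow_card_primeFactors_le {n : ℕ} (hn : n ≠ 0) : 2 ^ #n.primeFactors ≤ n :=
  calc 2 ^ #n.primeFactors ≤ ∏ p ∈ n.primeFactors, p :=
        Finset.pow_card_le_prod n.primeFactors (fun p => p) 2
          fun _ hp => (Nat.prime_of_mem_primeFactors hp).two_le
    _ ≤ n := Nat.le_of_dvd (Nat.pos_of_ne_zero hn) (Nat.prod_primeFactors_dvd n)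

/-- For an abc triple, `ω(abc) · log 2 ≤ 3 log c` (from `2^{ω(abc)} ≤ abc ≤ c³`). [folklore] -/
private theorem card_primeFactors_mul_log_two_le {a b : ℕ} (ha : 0 < a) (hb : 0 < b) :
    (#(a * b * (a + b)).primeFactors : ℝ) * Real.log 2 ≤ 3 * Real.log ((a + b : ℕ) : ℝ) := by
  have hn : a * b * (a + b) ≠ 0 := by positivity
  have h1 : 2 ^ #(a * b * (a + b)).primeFactors ≤ (a + b) ^ 3 :=
    (two_pow_card_primeFactors_le hn).trans <| by
      calc a * b * (a + b) ≤ (a + b) * (a + b) * (a + b) := by gcongr <;> omega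
        _ = (a + b) ^ 3 := by ring
  have h2 : (2 : ℝ) ^ #(a * b * (a + b)).primeFactors ≤ ((a + b : ℕ) : ℝ) ^ 3 := by
    exact_mod_cast h1
  have h3 := Real.log_le_log (by positivity) h2
  rwa [Real.log_pow, Real.log_pow, Nat.cast_ofNat] at h3

/-- **The Small Derivatives Conjecture holds with any exponent `η > 1`** (Pasten, §3.3, the remark
after Conjecture 3.9: "Lemma 3.5 shows that if we keep the `ψ`-independence condition, then a
version of the Small Derivatives Conjecture holds with exponent `η = 1 + ε` rather than the sought
`η < 1`"). For every abc triple with `(a, b) ≠ (1, 1)` Lemma 3.5 (`exists_adapted_independent_holds`)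
gives a `ψ`-independent `ψ ∈ 𝒯(a,b)` with `‖ψ‖ ≤ ω(abc)/(2 log 2) · c log c ≤ 3 c (log c)²/(2 (log 2)²)`,
which is `< c^η` once `c ≥ N(η)` because `(log c)² = o(c^{η − 1})`; hence every exceptional triple
lies in the finite box `a, b, c < max N 3`. The open content of Conjecture 3.9 is thus exactly the
range `η < 1`, where it implies Oesterlé's abc conjecture (`exists_exponent_of_smallDerivatives_holds`).
[cite: Pasten2021, §3.3 (remark after Conj. 3.9) and Lemma 3.5] -/
theorem smallDerivativesConjectureWith_of_one_lt {η : ℝ} (hη : 1 < η) :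
    SmallDerivativesConjectureWith η := by
  have hlog2 : 0 < Real.log 2 := Real.log_pos one_lt_two
  obtain ⟨δ, hδ⟩ : ∃ δ : ℝ, δ = η - 1 := ⟨_, rfl⟩
  have hδ0 : 0 < δ := by rw [hδ]; linarith
  have hηδ : η = 1 + δ := by rw [hδ]; ring
  -- `3 (log x)² / (2 (log 2)²) < x ^ δ` for all large real `x`, since `(log x)² = o(x^δ)`
  have hev : ∀ᶠ x : ℝ in Filter.atTop,
      3 * Real.log x ^ 2 / (2 * Real.log 2 ^ 2) < x ^ δ := by
    have hκ : (0 : ℝ) < Real.log 2 ^ 2 / 3 := by positivity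
    filter_upwards [(isLittleO_log_rpow_rpow_atTop 2 hδ0).def hκ,
      Filter.eventually_gt_atTop (1 : ℝ)] with x hx hx1
    have hx0 : 0 < x := by linarith
    have hxδ : 0 < x ^ δ := Real.rpow_pos_of_pos hx0 δ
    rw [Real.rpow_two, Real.norm_of_nonneg (by positivity),
      Real.norm_of_nonneg hxδ.le] at hx
    calc 3 * Real.log x ^ 2 / (2 * Real.log 2 ^ 2)
        ≤ 3 * (Real.log 2 ^ 2 / 3 * x ^ δ) / (2 * Real.log 2 ^ 2) := by gcongr
      _ = x ^ δ / 2 := by field_simp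
      _ < x ^ δ := by linarith
  -- … in particular for all naturals `c ≥ N`
  obtain ⟨N, hN⟩ : ∃ N : ℕ, ∀ c : ℕ, N ≤ c →
      3 * Real.log (c : ℝ) ^ 2 / (2 * Real.log 2 ^ 2) < (c : ℝ) ^ δ :=
    Filter.eventually_atTop.mp (tendsto_natCast_atTop_atTop.eventually hev)
  -- every exceptional triple lies in the box `a, b, c < max N 3`
  apply (Finset.range (max N 3) ×ˢ (Finset.range (max N 3) ×ˢ Finset.range (max N 3))).finite_toSet.subset
  rintro ⟨a, b, c⟩ ht
  simp only [Set.mem_setOf_eq] at ht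
  obtain ⟨⟨ha, hb, hsum, hcop⟩, -, hno⟩ := ht
  simp only [Finset.coe_product, Finset.coe_range, Set.mem_prod, Set.mem_Iio]
  suffices hc : c < max N 3 by omega
  by_contra hcN
  rw [not_lt] at hcN
  have hNc : N ≤ c := le_of_max_le_left hcN
  have h3c : 3 ≤ c := le_of_max_le_right hcN
  apply hno
  subst hsum
  have h11 : (a, b) ≠ (1, 1) := by
    intro h
    obtain ⟨rfl, rfl⟩ := Prod.mk.inj h
    omega
  obtain ⟨ψ, had, hW, hbound⟩ := exists_adapted_independent_holds a b ⟨ha, hb, rfl, hcop⟩ h11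
  refine ⟨ψ, had, hW, fun p => ?_⟩
  -- `‖ψ‖ ≤ ω/(2 log 2) · x log x ≤ 3 x (log x)²/(2 (log 2)²) < x · x^δ = x^η`, `x = c`
  obtain ⟨x, hx⟩ : ∃ x : ℝ, x = ((a + b : ℕ) : ℝ) := ⟨_, rfl⟩
  have hx3 : (3 : ℝ) ≤ x := by rw [hx]; exact_mod_cast h3c
  have hx0 : 0 < x := by linarith
  have hlogx : 0 ≤ Real.log x := Real.log_nonneg (by linarith)
  have hω : (#(a * b * (a + b)).primeFactors : ℝ) ≤ 3 * Real.log x / Real.log 2 := by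
    rw [le_div_iff₀ hlog2, hx]
    exact card_primeFactors_mul_log_two_le ha hb
  have hsmall : 3 * Real.log x ^ 2 / (2 * Real.log 2 ^ 2) < x ^ δ := by
    rw [hx]; exact hN (a + b) hNc
  rw [← hx] at hbound ⊢
  calc (|ψ p| : ℝ) ≤ (#(a * b * (a + b)).primeFactors : ℝ) / (2 * Real.log 2) * (x * Real.log x) :=
        hbound p
    _ ≤ 3 * Real.log x / Real.log 2 / (2 * Real.log 2) * (x * Real.log x) := by gcongr
    _ = x * (3 * Real.log x ^ 2 / (2 * Real.log 2 ^ 2)) := by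
        field_simp
    _ < x * x ^ δ := by gcongr
    _ = x ^ η := by rw [hηδ, Real.rpow_add hx0, Real.rpow_one]

end Pasten

end Literature.Barriers.ABC
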